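import Mathlib
import HarnessLib
import Summits.HubbardSuperconductivity.HubbardSuperconductivity.Theorems.KLProgrammeMatsubaraSliceBubbleTransfer

/-!
# Route `KLProgramme` — crux K3 split, ENGINE child (`KLRegimeEngineV11` stmt-HubbardSuperconductivity-19823): the SIGN-BLIND scale form of a
# slice bubble — one slice-`n` propagator times ANY bounded partner (the particle–particle partner `(−ω, Q−k)`, a propagator of another scale, …)
# (cell gate-hubbard-kl, seat hubbard-kl-k3c2-p2 «thermal-bar induction n ≤ nScales β + 1»)

No cancellation: `‖β⁻¹ • Σ_i ∫ W(e)·Φ(ω_i,e)·Ψ_i(e) de‖ ≤ (256/π)·M_f·B_W·A'·Λ_n` at `n ≤ n_β + 1`, where `Φ(k₀,e) = f(s)(−ik₀+e)⁻¹` is the slice-`n`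
propagator in singularity-free form (`‖f‖ ≤ M_f`, `f = 0` for `s ≤ (Λ_n/2)²` and `s ≥ (4Λ_n)²`), `‖W‖ ≤ B_W` on `|e| < 4Λ_n`, and the partner `Ψ_i`
is ANY family with `‖Ψ_i(e)‖ ≤ A'` on `|e| < 4Λ_n` (`klsb2_slice_bubble_signblind_norm_le`).  With `A' = 2M'/Λ_n` (another slice-`n` propagator,
`klsp_div_propagator_norm_le`) this is the marginal `O(1)`: `(512/π)·M_f·M'·B_W` per unit local-coupling² (`…_pair`) — the particle–particle same-slice
bubble mass that `G.bhi` / `ppGain ≤ 1` majorise, and the fall-back wherever no gain is needed.  From `klsp_discrete_sum_norm_le` and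
`klsp_count_factor_le`.  Pure analysis.
-/

noncomputable section

namespace Summit.HubbardSuperconductivity.HubbardSuperconductivity.Theorems.KLRegimeSplit

set_option linter.dupNamespace false -- summit = problem name (single-conjunct summit), D-0017

open Real Set MeasureTheory Complex Literature.MathematicalPhysics.QuantumLattice Literature.Probability.LatticeModels
open Summit.HubbardSuperconductivity.HubbardSuperconductivity.Theorems.KLProgrammeLegKernels

section SignBlind

variable {f : ℝ → ℂ} {Mf : ℝ} {W : ℝ → ℂ} {BW A' : ℝ}

/-- **Sign-blind slice bubble, scale form.**  At `n ≤ n_β + 1` (`β ≥ klBetaMin`), for the slice-`n` weight `f` (`‖f‖ ≤ M_f`, `f(s) = 0` for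
`s ≤ (Λ_n/2)²` and for `s ≥ (4Λ_n)²`), an insertion with `‖W(e)‖ ≤ B_W` for `|e| < 4Λ_n`, and ANY partner family `Ψ : MatsubaraIdx M → ℝ → ℂ` with
`‖Ψ i e‖ ≤ A'` for `|e| < 4Λ_n` (`0 ≤ B_W, A'`):
`‖β⁻¹ • Σ_i ∫ W(e)·((f(s)/s)(iω_i+e))·Ψ i e de‖ ≤ (256/π)·M_f·B_W·A'·Λ_n`. -/
theorem klsb2_slice_bubble_signblind_norm_le (hbd : ∀ s, ‖f s‖ ≤ Mf) {n : ℕ}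
    (hin : ∀ s, s ≤ (klScale klE0 n / 2) ^ 2 → f s = 0) (hout : ∀ s, (4 * klScale klE0 n) ^ 2 ≤ s → f s = 0)
    (hBW : 0 ≤ BW) (hWbd : ∀ e, |e| < 4 * klScale klE0 n → ‖W e‖ ≤ BW)
    {M : ℕ} {Ψ : MatsubaraIdx M → ℝ → ℂ} (hA' : 0 ≤ A') (hΨ : ∀ i e, |e| < 4 * klScale klE0 n → ‖Ψ i e‖ ≤ A')
    {β : ℝ} (hβ : klBetaMin ≤ β) (hn : n ≤ nScales β + 1) :
    ‖β⁻¹ • ∑ i : MatsubaraIdx M, ∫ e,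
        W e * (f (matsubaraFreq β M i ^ 2 + e ^ 2) / (((matsubaraFreq β M i ^ 2 + e ^ 2 : ℝ)) : ℂ) * (I * (matsubaraFreq β M i) + e)) *
          Ψ i e‖ ≤ 256 / Real.pi * Mf * BW * A' * klScale klE0 n := by
  set Λ := klScale klE0 n with hΛdef
  have hΛ : 0 < Λ := klth_klScale_pos n
  have hβ0 : 0 < β := pos_of_klBetaMin_le hβ
  have hMf : 0 ≤ Mf := (norm_nonneg _).trans (hbd 0)
  have hr₁ : 0 < Λ / 2 := by positivity
  have hr : 0 < 4 * Λ := by positivity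
  -- the slice propagator: sup and support
  have hgsupp : ∀ s, (4 * Λ) ^ 2 ≤ s → (fun s : ℝ => f s / ((s : ℝ) : ℂ)) s = 0 := fun s hs => by
    simp only [hout s hs, zero_div]
  have hΦbd : ∀ k₀ e : ℝ, ‖f (k₀ ^ 2 + e ^ 2) / (((k₀ ^ 2 + e ^ 2 : ℝ)) : ℂ) * (I * k₀ + e)‖ ≤ Mf / (Λ / 2) := fun k₀ e =>
    klsp_div_propagator_norm_le hbd hin hr₁ k₀ e
  have hΦfst : ∀ k₀ : ℝ, 4 * Λ ≤ |k₀| → ∀ e : ℝ, f (k₀ ^ 2 + e ^ 2) / (((k₀ ^ 2 + e ^ 2 : ℝ)) : ℂ) * (I * k₀ + e) = 0 :=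
    fun k₀ hk e => klsp_zero_of_le_abs_fst hgsupp hr.le hk e
  have hΦsnd : ∀ k₀ e : ℝ, 4 * Λ ≤ |e| → f (k₀ ^ 2 + e ^ 2) / (((k₀ ^ 2 + e ^ 2 : ℝ)) : ℂ) * (I * k₀ + e) = 0 :=
    fun k₀ e he => klsp_zero_of_le_abs_snd hgsupp hr.le k₀ he
  -- the sum is over a family indexed by `i`; `klsp_discrete_sum_norm_le` wants `h (ω_i) e` — encode `i` through a pointwise bound uniform in `i`
  -- by bounding each term and summing by hand along the same lines.
  have hB : 0 ≤ BW * (Mf / (Λ / 2)) * A' := by positivity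
  -- per-term bound
  have hterm : ∀ i : MatsubaraIdx M,
      ‖∫ e, W e * (f (matsubaraFreq β M i ^ 2 + e ^ 2) / (((matsubaraFreq β M i ^ 2 + e ^ 2 : ℝ)) : ℂ) *
          (I * (matsubaraFreq β M i) + e)) * Ψ i e‖ ≤
        if |matsubaraFreq β M i| < 4 * Λ then 2 * (4 * Λ) * (BW * (Mf / (Λ / 2)) * A') else 0 := by
    intro i
    split_ifs with hi
    · refine klsp_norm_integral_slice_le hr.le (fun e => ?_) (fun e he => ?_)
      · by_cases he : |e| < 4 * Λ
        · rw [norm_mul, norm_mul]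
          exact mul_le_mul (mul_le_mul (hWbd e he) (hΦbd _ e) (norm_nonneg _) hBW) (hΨ i e he) (norm_nonneg _) (by positivity)
        · rw [hΦsnd _ e (not_lt.mp he), mul_zero, zero_mul, norm_zero]; exact hB
      · rw [hΦsnd _ e he, mul_zero, zero_mul]
    · simp_rw [hΦfst _ (not_lt.mp hi), mul_zero, zero_mul]
      rw [integral_zero, norm_zero]
  have hcard := card_filter_matsubaraFreq_le hβ0 hr.le (Finset.univ.filter fun i : MatsubaraIdx M => |matsubaraFreq β M i| < 4 * Λ)
    (fun i hi => ((Finset.mem_filter.mp hi).2).le)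
  have hsum : ∑ i : MatsubaraIdx M, (if |matsubaraFreq β M i| < 4 * Λ then 2 * (4 * Λ) * (BW * (Mf / (Λ / 2)) * A') else 0) =
      ((Finset.univ.filter fun i : MatsubaraIdx M => |matsubaraFreq β M i| < 4 * Λ).card : ℝ) * (2 * (4 * Λ) * (BW * (Mf / (Λ / 2)) * A')) := by
    rw [Finset.sum_ite, Finset.sum_const_zero, add_zero, Finset.sum_const, nsmul_eq_mul]
  have hcount := klsp_count_factor_le hβ hn
  rw [← hΛdef] at hcount
  calc ‖β⁻¹ • ∑ i : MatsubaraIdx M, ∫ e, W e * (f (matsubaraFreq β M i ^ 2 + e ^ 2) /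
          (((matsubaraFreq β M i ^ 2 + e ^ 2 : ℝ)) : ℂ) * (I * (matsubaraFreq β M i) + e)) * Ψ i e‖
      = β⁻¹ * ‖∑ i : MatsubaraIdx M, ∫ e, W e * (f (matsubaraFreq β M i ^ 2 + e ^ 2) /
          (((matsubaraFreq β M i ^ 2 + e ^ 2 : ℝ)) : ℂ) * (I * (matsubaraFreq β M i) + e)) * Ψ i e‖ := by
        rw [norm_smul, norm_inv, Real.norm_of_nonneg hβ0.le]
    _ ≤ β⁻¹ * ∑ i : MatsubaraIdx M, (if |matsubaraFreq β M i| < 4 * Λ then 2 * (4 * Λ) * (BW * (Mf / (Λ / 2)) * A') else 0) :=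
        mul_le_mul_of_nonneg_left ((norm_sum_le _ _).trans (Finset.sum_le_sum fun i _ => hterm i)) (inv_nonneg.mpr hβ0.le)
    _ ≤ β⁻¹ * ((4 * Λ * β / Real.pi + 3) * (2 * (4 * Λ) * (BW * (Mf / (Λ / 2)) * A'))) := by
        rw [hsum]; exact mul_le_mul_of_nonneg_left (mul_le_mul_of_nonneg_right hcard (by positivity)) (inv_nonneg.mpr hβ0.le)
    _ = (4 * Λ / Real.pi + 3 / β) * (2 * (4 * Λ) * (BW * (Mf / (Λ / 2)) * A')) := by field_simp
    _ ≤ (16 / Real.pi * Λ) * (2 * (4 * Λ) * (BW * (Mf / (Λ / 2)) * A')) := mul_le_mul_of_nonneg_right hcount (by positivity)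
    _ = 256 / Real.pi * Mf * BW * A' * Λ := by field_simp; ring

/-- **The pair of slice propagators, sign-blind**: with the partner `Ψ i e = (f'(s')/s')(ik₀'+e')` any slice-`n` propagator evaluated anywhere
(`‖f'‖ ≤ M'`, `f' = 0` for `s ≤ (Λ_n/2)²`, so `‖Ψ‖ ≤ 2M'/Λ_n` by `klsp_div_propagator_norm_le`), the bubble is `≤ (512/π)·M_f·M'·B_W` — the marginal
`O(1)` per unit local-coupling² (no gain, no loss), uniformly in `n ≤ n_β + 1`, `β`, `M`. -/
theorem klsb2_slice_bubble_signblind_pair_norm_le {f' : ℝ → ℂ} {Mf' : ℝ} (hbd : ∀ s, ‖f s‖ ≤ Mf) {n : ℕ}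
    (hin : ∀ s, s ≤ (klScale klE0 n / 2) ^ 2 → f s = 0) (hout : ∀ s, (4 * klScale klE0 n) ^ 2 ≤ s → f s = 0)
    (hbd' : ∀ s, ‖f' s‖ ≤ Mf') (hin' : ∀ s, s ≤ (klScale klE0 n / 2) ^ 2 → f' s = 0)
    (hBW : 0 ≤ BW) (hWbd : ∀ e, |e| < 4 * klScale klE0 n → ‖W e‖ ≤ BW)
    {M : ℕ} (κ : MatsubaraIdx M → ℝ) (η : MatsubaraIdx M → ℝ → ℝ)
    {β : ℝ} (hβ : klBetaMin ≤ β) (hn : n ≤ nScales β + 1) :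
    ‖β⁻¹ • ∑ i : MatsubaraIdx M, ∫ e,
        W e * (f (matsubaraFreq β M i ^ 2 + e ^ 2) / (((matsubaraFreq β M i ^ 2 + e ^ 2 : ℝ)) : ℂ) * (I * (matsubaraFreq β M i) + e)) *
          (f' (κ i ^ 2 + η i e ^ 2) / (((κ i ^ 2 + η i e ^ 2 : ℝ)) : ℂ) * (I * (κ i) + η i e))‖ ≤
      512 / Real.pi * Mf * Mf' * BW := by
  have hΛ : 0 < klScale klE0 n := klth_klScale_pos n
  have hMf' : 0 ≤ Mf' := (norm_nonneg _).trans (hbd' 0)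
  have hr₁ : 0 < klScale klE0 n / 2 := by positivity
  have hA' : 0 ≤ Mf' / (klScale klE0 n / 2) := by positivity
  have h := klsb2_slice_bubble_signblind_norm_le (Ψ := fun i e => f' (κ i ^ 2 + η i e ^ 2) / (((κ i ^ 2 + η i e ^ 2 : ℝ)) : ℂ) * (I * (κ i) + η i e))
    hbd hin hout hBW hWbd hA' (fun i e _ => klsp_div_propagator_norm_le hbd' hin' hr₁ (κ i) (η i e)) hβ hn
  refine h.trans (le_of_eq ?_)
  field_simp
  ring

end SignBlind

end Summit.HubbardSuperconductivity.HubbardSuperconductivity.Theorems.KLRegimeSplit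

end
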